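import Mathlib.Topology.Instances.ZMod
import Mathlib.Algebra.Field.ZMod
import Literature.NumberTheory.EllipticCurves.NewformGaloisRep
import HarnessLib

/-!
# Deligne–Serre 1974, Thm. 6.7: mod-`ℓ` Galois representations attached to weight-one newforms

Deligne–Serre, *Formes modulaires de poids 1*, Ann. Sci. ÉNS (4) 7 (1974), §6 (b) ("Réduction
mod `ℓ`"), Thm. 6.7, vendored as a named fact (D-0014) in the special case used in op. cit. §8.2
for the proof of Thm. 4.1: a **weight-one newform** `f ∈ S_1(Γ₁(N))` and a prime `λ` of its
coefficient ring with residue field the prime field `𝔽_ℓ` (`ℓ` split in `K_f`, §8.2).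

* `Literature.NumberTheory.EllipticCurves.ModularForms.DeligneSerre1974.thm67_weightOne` — for every ring homomorphism
  `ι : 𝓞_f →+* 𝔽_ℓ` (`𝓞_f = coeffCharIntegers f`, the ring of integers of the coefficient field
  with character values `K_f = coeffCharField f`) there is a semisimple continuous
  representation `ρ : Gal(ℚ̄/ℚ) → GL₂(𝔽_ℓ)`, unramified outside `N ℓ`, whose arithmetic
  Frobenii at `p ∤ N ℓ` have characteristic polynomial `X² − ι(a_p) X + ι(ε(p))`
  (`IsGaloisRepOfNewform1Int f ι {p ∣ N ℓ} ρ`).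

Why this is a special case of the printed Thm. 6.7 (with the notation of op. cit. 6.6:
`K ⊂ ℂ` a number field containing the coefficients, `λ` a finite place of `K`, `𝒪_λ`, `k_λ`; `f`
`λ`-integral, `f ≢ 0 (mod λ)`, `f | T_p ≡ a_p f (mod λ)` for `p ∤ N ℓ`; conclusion: a semisimple
`ρ : G → GL₂(k_f)`, `k_f ⊆ k_λ` the subfield generated by the `a_p` and the `ε(p) mod λ`,
unramified outside `N ℓ`, with `Tr(F_p) = a_p`, `det(F_p) = ε(p) p^{k-1}` (6.7.1)): for a
newform, `K = K_f` is a number field and the `a_n` are integers of `K` (op. cit. (2.7.3);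
Shimura 1971, Thm. 3.48), so `f` is `λ`-integral for `λ = ker ι`, `f ≢ 0 (mod λ)` as `a_1 = 1`,
and `f` is a genuine `T_p`-eigenvector; as `𝓞_f / ker ι ↪ 𝔽_ℓ` is the prime field,
`k_f = k_λ = 𝔽_ℓ`; in weight `1`, `p^{k-1} = 1`; for `2 × 2` matrices (6.7.1) is the statement
`charpoly = X² − a_p X + ε(p)`; and representations over a finite field are continuous for its
discrete topology (§3 (c)). The proof in print (6.8–6.13) multiplies by Eisenstein series
`E_{ℓ-1}ⁿ ≡ 1 (mod ℓ)` to raise the weight, applies the Deligne–Serre lifting lemma (Lemme 6.11,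
proved in `Literature.RingTheory.DiscreteValuationRing.DeligneSerreLiftingProofs`) and reduces
Deligne's `λ`-adic representations (Thm. 6.1, `Literature.NumberTheory.EllipticCurves.ModularForms.exists_padicGaloisRep_of_isNewform1`)
modulo `λ`; Mathlib has no congruences of `q`-expansions modulo `ℓ`, hence a named fact.

## References

* P. Deligne, J.-P. Serre, *Formes modulaires de poids 1*, Ann. Sci. ÉNS (4) 7 (1974), 507–530,
  6.6 and Thm. 6.7 (pp. 521–523), §8.2 (p. 525).
-/

noncomputable section

open scoped MatrixGroups ModularForm NumberField

open CongruenceSubgroup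

namespace Literature.NumberTheory.EllipticCurves.ModularForms.DeligneSerre1974

variable {N : ℕ} [NeZero N]

/-- **Deligne–Serre 1974, Thm. 6.7** (weight one, residue field `𝔽_ℓ`; the case of §8.2). Let
`f ∈ S_1(Γ₁(N))` be a newform with coefficients `a_p` and nebentypus `ε`, `ℓ` a prime and
`ι : 𝓞_f →+* 𝔽_ℓ` a ring homomorphism (a prime `λ = ker ι` of `K_f` with `k_λ = 𝔽_ℓ`). Then
there is a semisimple continuous representation `ρ : Gal(ℚ̄/ℚ) → GL₂(𝔽_ℓ)` (discrete topology),
unramified outside `N ℓ`, such that for every prime `p ∤ N ℓ` the arithmetic Frobenii at `p`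
have characteristic polynomial `X² − ι(a_p) X + ι(ε(p))` (6.7.1).
[cite: DeligneSerreASENS1974, Thm. 6.7 and §8.2] -/
def thm67_weightOne : Prop :=
  ∀ {f : CuspForm (Gamma1 N) 1} (_hf : IsNewform1 f) (ℓ : ℕ) [Fact ℓ.Prime]
    (ι : coeffCharIntegers f →+* ZMod ℓ),
    ∃ ρ : GaloisRepresentations.FramedGaloisRep ℚ (ZMod ℓ) 2,
      IsGaloisRepOfNewform1Int f ι {p | p ∣ N * ℓ} ρ ∧ ρ.toGaloisRep.IsSemisimple

end Literature.NumberTheory.EllipticCurves.ModularForms.DeligneSerre1974
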